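import Summits.BirchSwinnertonDyer.Rank1Residual.Additive.XMultRankZeroCyclotomicPrimePrep
import Summits.BirchSwinnertonDyer.Rank1Residual.Additive.CyclotomicZpExtensionPrime
import Summits.BirchSwinnertonDyer.Rank1Residual.Additive.SelmerControlFiniteness
import Summits.BirchSwinnertonDyer.Rank1Residual.Additive.CyclotomicPrimeShaRestriction
import HarnessLib

/-!
# X3/X4, (M)-rows at an odd `p` — `V = W^{(p*)}` MULTIPLICATIVE at `p` (split or non-split) — ranks
# `(0,0)`, over `F = ℚ(ζ_p)`, ALL `p − 1` branches (line V19b, abstract core):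
# `ord_p#Ш(V) + ord_p#Ш(W) ≤ ord_p#Ш_an(V) + ord_p#Ш_an(W) + explicit terms`

HONEST FRAMING (cell `b2b-bsdres`, run/shared/lean/b2b/bsd-rank1-residual/, verbatim in every
file): the goal of the cell is to DELETE the COMBINATION-SHAPED residual classes of the
Birch–Swinnerton-Dyer formula for ALL analytic-rank `≤ 1` elliptic curves over `ℚ` — "full BSD
formula for every rank `≤ 1` curve in class `C`" assembled STRICTLY from published theorems — so
that the rank-`≤ 1` remainder becomes exactly the CONSTRUCTION-SHAPED classes, which are TYPED
(missing-input `Prop`s), NOT attempted. This is not "finishing BSD". Seat additive-p4 (research route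
on X3/X4); the labels of X3 and X4 are UNCHANGED by this file; nothing is booked here.

Theorems only (no `def`, no `sorry`, no new named fact). Line V19 (`XGordRankZeroCyclotomicPrime`)
treated the (G-ord, `e = 2`) rows at every odd `p` over `F = ℚ(ζ_p)`; line V19b does the same for the
(M)-rows: `W` additive at `p` of Kodaira type `I_n*`, `V = W^{(p*)}` MULTIPLICATIVE at `p`. The two
local types at `p` — non-split (`a_p(V) = −1`, no exceptional zero; Greenberg's factor `l_𝔭 = 1`)
and split (`a_p(V) = +1`, exceptional zero of the branch `ω⁰`, Greenberg–Stevens, Greenberg's factor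
`l_𝔭 = 𝓛_p(V)/(2p)`) — are treated AT ONCE by this ABSTRACT core: the `ω⁰`-branch enters only
through a power series `L♯` with `L♯(0)·μ = e·λ·[0]⁺_f` (`μ, e ≠ 0` of EQUAL valuation, `λ ≠ 0`),
the divisibility over `F` as `ι g = u ϖ^m ϖ'^m · L♯ · ∏_{0<i<p−1} B_i` (`B_i` the tame branches of
the ONE-TERM measure), and Greenberg's display over `F` as `f_E(0)·#V(F)[p^∞]² = u·λ·p^{v_F}·#Sel`;
`λ` CANCELS. Instances (file `XMultRankZeroCyclotomicPrimeReduction`): non-split — `L♯ = L_p(V,T)`,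
`μ = 1`, `e = 2`, `λ = 1`; split — `L♯ = L_p(V,T)/T`, `μ = log_p γ_cyc`, `e = 2p`, `λ = 𝓛_p(V)/(2p)`.
Other inputs, all tree theorems: control (`Sel_{p^∞}(V/F)` finite from `g(0) ≠ 0`,
`SelmerControlFiniteness`), the MIDDLE branch against `L(W,1)/Ω_W` by Birch + Pal both parities
(`XMultCyclotomicPrime.exists_midBranch_datum`), the descent `ℚ → F`:
`ord_p#Ш(V) + ord_p#Ш(W) ≤ ord_p #Sel_{p^∞}(V/F)` (`CyclotomicPrimeShaRestriction`), the cyclotomic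
setting over `F` (`exists_isCyclotomic_isTopGenerator_cyclotomicPrime`). What does NOT cancel over `F`
is carried as EXPLICIT per-pair terms exactly as in V19: the other branch values
`o = ∏_{i ∉ {0,m}} B_i(0)`, `ord_p ∏_w c_w(V_F)`, `ord_p #V(F)`, and the period exponents.
-/

noncomputable section

open scoped Classical MatrixGroups ModularForm

open CongruenceSubgroup WeierstrassCurve NumberField IsDedekindDomain
  Literature.NumberTheory.EllipticCurves Literature.NumberTheory.EllipticCurves.ModularForms
  Literature.NumberTheory.EllipticCurves.Rank1Residual
  Literature.NumberTheory.EllipticCurves.Rank1Residual.Typed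
  Literature.NumberTheory.GaloisRepresentations

namespace Summit.BirchSwinnertonDyer.Rank1Residual.Additive

section Core

variable (p : ℕ) [hp : Fact p.Prime] (F : Type) [Field F] [NumberField F] [IsCyclotomicExtension {p} ℚ F]
  (V : WeierstrassCurve ℚ) [V.IsElliptic] [V.IsGloballyMinimal]
  (W : WeierstrassCurve ℚ) [W.IsElliptic] [W.IsGloballyMinimal]

/-- **Abstract core theorem (line V19b, odd `p`, multiplicative twist, rank `0 + 0`, all branches
over `F = ℚ(ζ_p)`).** Let `V/ℚ` be globally minimal, MULTIPLICATIVE at the odd prime `p`, with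
newform `f` of level `N`, `p ∣ N`, `a_p(f) = ap ∈ {±1}`, and `W = C • V^{(p*)}` a globally minimal
model of its twist, ADDITIVE at `p`, both of analytic rank `0`; `ϖ·Ω_V = Ω⁺_f`, `ϖ'·|Ω⁻(V)| = Ω⁻_f`,
`B_i = L_p(f,ap,ω^i,T)` the tame branches of the ONE-TERM measure (`padicLFunctionPlusBranchMult`
for even `i`, `padicLFunctionMinusBranchMult` for odd `i`). Let `L♯ ∈ ℚ_p⟦T⟧` and `λ, μ, e ∈ ℚ_p`,
`λ, μ, e ≠ 0`, `v(μ) = v(e)`, with `L♯(0)·μ = e·λ·[0]⁺_f`. ASSUME, over `F`: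
* `hDivF` — `X(V/F_∞)` is `Λ`-torsion and `u ϖ^{m}ϖ'^{m}·L♯·∏_{0<i<p−1} B_i = ι g` for some
  `g ∈ char_Λ X(V/F_∞)`, `m = (p−1)/2` (the shape of Wuthrich Thm. 16 / Kato-as-attributed read over
  `F`, after removing the factor `T` in the split case);
* `hGrF` — Greenberg's display over `F` at the unique prime above `p`: `Sel_{p^∞}(V_F/F)` finite and
  `char = (f_E)` ⇒ `f_E(0)·#V(F)[p^∞]² = u·λ·p^{ord_p ∏_w c_w(V_F)}·#Sel_{p^∞}(V_F/F)`;
* `hO` — the other branch constant terms are non-zero: `o = ∏_{0<i<p−1, i≠m} B_i(0) ≠ 0`.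
THEN, with Gross–Zagier–Kolyvagin (`hGZK`) and modularity (`hmod`): `#Ш_an(V) = q_V`,
`#Ш_an(W) = q_W` are rationals with
**`ord_p #Ш(V) + ord_p #Ш(W) + ord_p ∏_w c_w(V_F) + 2(ord_p #V(ℚ) + ord_p #W(ℚ)) ≤ ord_p q_V + ord_p q_W
+ ord_p ∏c(V) + ord_p ∏c(W) + 2 ord_p #V(F) + v(o) + m(ord_p ϖ + ord_p ϖ') − ord_p ϖ − ord_p ϖ_mid`**
(`ϖ_mid = ϖ` if `p ≡ 1 (mod 4)`, `ϖ'` if `p ≡ 3 (mod 4)`) — `λ` cancels. Proof: module docstring.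
[cite: Wuthrich2014, Thm. 16 (p. 397), Thm. 3 (p. 383), Cor. 19 (p. 398)]
[cite: GreenbergLNM1716, §4 pp. 112–113, Lemma 4.2 (p. 103), Lemma 3.1 (p. 86)]
[cite: MazurTateTeitelbaum1986Invent, §I.10, §I.13–I.14] [cite: DokchitserDokchitserAnnals2010, Lemma 4.14 (proof)] -/
theorem XMultCyclotomicPrime.exists_padicVal_shaOrder_add_le
    (hGZK : rank_eq_analyticRank_of_analyticRank_le_one) (hmod : hasEntireLFunction_rat)
    (hp2 : p ≠ 2) (C : VariableChange ℚ) (hC : C • V.quadraticTwist ((-1 : ℚ) ^ (p / 2) * p) = W)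
    (hmult : V.HasMultiplicativeReductionAtPrime p) (hadd : Addv W p)
    (hrV : V.analyticRank = 0) (hrW : W.analyticRank = 0)
    {N : ℕ} [NeZero N] {f : CuspForm (Gamma0 N) 2} (hf : IsNewformOf V f) (hpN : p ∣ N)
    {ap : ℤ} (hap : cuspCoeff f p = ap) (hap1 : ap = 1 ∨ ap = -1)
    (ϖ ϖ' : ℚ) (hϖ : (ϖ : ℝ) * V.realPeriodRat = plusPeriod f)
    (hϖ' : (ϖ' : ℝ) * V.imaginaryPeriodRat = minusPeriod f)
    (Ls : PowerSeries ℚ_[p]) (lam μ e : ℚ_[p]) (hlam : lam ≠ 0) (hμ0 : μ ≠ 0) (he0 : e ≠ 0)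
    (hμe : μ.valuation = e.valuation)
    (hLs : PowerSeries.constantCoeff Ls * μ = e * lam * (ratPlusSymbol f 0 : ℚ_[p]))
    (hDivF : ∀ (κ : ZpExtension F p) (γ : Field.absoluteGaloisGroup F),
      κ.IsCyclotomic → κ.IsTopGenerator γ →
      (∃ ζ : ℤ_[p]ˣ, IsOfFinOrder ζ ∧
        ((GaloisRep.cyclotomicCharacter F p γ * ζ : ℤ_[p]ˣ) : ℤ_[p]) = (cyclotomicGenerator p : ℤ_[p])) →
      ∀ D : (V.baseChange F).SelmerDualData κ γ,
        D.IsTorsion ∧ ∃ g ∈ D.charIdeal, ∃ u : ℤ_[p]ˣ,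
          iwasawaToPowerSeries p g =
            PowerSeries.C (((u : ℤ_[p]) : ℚ_[p]) * (ϖ : ℚ_[p]) ^ (p / 2) * (ϖ' : ℚ_[p]) ^ (p / 2)) *
              (Ls * ∏ i ∈ Finset.Ico 1 (p - 1),
                (if Even i then padicLFunctionPlusBranchMult f (ap : ℚ_[p]) i
                  else padicLFunctionMinusBranchMult f (ap : ℚ_[p]) i)))
    (hGrF : ∀ (κ : ZpExtension F p) (γ : Field.absoluteGaloisGroup F),
        κ.IsCyclotomic → κ.IsTopGenerator γ →
      ∀ (D : (V.baseChange F).SelmerDualData κ γ) [Module.Finite (IwasawaAlgebra p) D.X], D.IsTorsion →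
      ∀ (fE : IwasawaAlgebra p), D.charIdeal = Ideal.span {fE} →
        Finite ((V.baseChange F).selmerGroupPInfty p) →
        ∃ u : ℤ_[p]ˣ,
          ((PowerSeries.constantCoeff fE : ℤ_[p]) : ℚ_[p]) *
              (Nat.card (AddCommGroup.primaryComponent (V.baseChange F).toAffine.Point p) : ℚ_[p]) ^ 2 =
            ((u : ℤ_[p]) : ℚ_[p]) * lam * (p : ℚ_[p]) ^ (padicValNat p (V.baseChange F).tamagawaProduct) *
              (Nat.card ((V.baseChange F).selmerGroupPInfty p) : ℚ_[p]))
    (hO : (∏ i ∈ (Finset.Ico 1 (p - 1)).erase (p / 2),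
        PowerSeries.constantCoeff
          (if Even i then padicLFunctionPlusBranchMult f (ap : ℚ_[p]) i
            else padicLFunctionMinusBranchMult f (ap : ℚ_[p]) i)) ≠ 0) :
    ∃ qV qW : ℚ, shaAn V = (qV : ℂ) ∧ shaAn W = (qW : ℂ) ∧
      (padicValNat p V.shaOrder : ℤ) + padicValNat p W.shaOrder +
            padicValNat p (V.baseChange F).tamagawaProduct +
            2 * (padicValNat p (Nat.card V.toAffine.Point) + padicValNat p (Nat.card W.toAffine.Point)) ≤
        padicValRat p qV + padicValRat p qW +
          padicValNat p V.tamagawaProduct + padicValNat p W.tamagawaProduct +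
          2 * padicValNat p (Nat.card (V.baseChange F).toAffine.Point) +
          (∏ i ∈ (Finset.Ico 1 (p - 1)).erase (p / 2),
              PowerSeries.constantCoeff
                (if Even i then padicLFunctionPlusBranchMult f (ap : ℚ_[p]) i
                  else padicLFunctionMinusBranchMult f (ap : ℚ_[p]) i)).valuation +
          ((p / 2 : ℕ) : ℤ) * (padicValRat p ϖ + padicValRat p ϖ') - padicValRat p ϖ -
          (if p % 4 = 1 then padicValRat p ϖ else padicValRat p ϖ') := by
  classical
  haveI : NeZero p := ⟨hp.out.ne_zero⟩
  have hp3 : 3 ≤ p := by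
    have h2 := hp.out.two_le
    omega
  haveI : (V.baseChange F).IsElliptic := by rw [baseChange]; infer_instance
  -- names for the analytic objects
  set a : ℚ_[p] := (ap : ℚ_[p]) with ha
  set B : ℕ → PowerSeries ℚ_[p] := fun i ↦
    (if Even i then padicLFunctionPlusBranchMult f a i else padicLFunctionMinusBranchMult f a i) with hB
  set o : ℚ_[p] := ∏ i ∈ (Finset.Ico 1 (p - 1)).erase (p / 2), PowerSeries.constantCoeff (B i) with ho
  -- `a = ±1`
  have ha1 : a = 1 ∨ a = -1 := by
    rcases hap1 with h | h
    · left; rw [ha, h]; norm_num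
    · right; rw [ha, h]; norm_num
  have ha0 : a ≠ 0 := by rcases ha1 with h | h <;> rw [h] <;> norm_num
  have hva : a.valuation = 0 := by
    rcases ha1 with h | h
    · rw [h, Padic.valuation_one]
    · -- `v(−1) = 0`: `(−1)·(−1) = 1`
      have hm1 : (-1 : ℚ_[p]) ≠ 0 := by norm_num
      have h2 : ((-1 : ℚ_[p]) * (-1)).valuation = (-1 : ℚ_[p]).valuation + (-1 : ℚ_[p]).valuation :=
        Padic.valuation_mul hm1 hm1
      rw [show ((-1 : ℚ_[p]) * (-1)) = 1 by ring, Padic.valuation_one] at h2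
      rw [h]
      linarith
  -- rank 0: `L(·,1) ≠ 0`, Mordell–Weil groups and `Ш` finite
  have hLV : V.entireLFunction 1 ≠ 0 := (V.analyticRank_eq_zero_iff_holds (hmod V)).mp hrV
  have hLW : W.entireLFunction 1 ≠ 0 := (W.analyticRank_eq_zero_iff_holds (hmod W)).mp hrW
  obtain ⟨hmwV, hfinV⟩ := hGZK V (by rw [hrV]; exact zero_le_one)
  obtain ⟨hmwW, hfinW⟩ := hGZK W (by rw [hrW]; exact zero_le_one)
  haveI : Finite V.sha := hfinV
  haveI : Finite W.sha := hfinW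
  haveI hEV : Finite V.toAffine.Point := V.finite_point_of_rank_zero (by rw [hmwV, hrV])
  haveI hEW : Finite W.toAffine.Point := W.finite_point_of_rank_zero (by rw [hmwW, hrW])
  set VF := V.baseChange F with hVF
  -- the cyclotomic setting over `F`, the Iwasawa module `X(V/F_∞)`
  obtain ⟨κ, hκ, γ, hγ, hγ'⟩ := exists_isCyclotomic_isTopGenerator_cyclotomicPrime p F
  obtain ⟨D⟩ := VF.nonempty_selmerDualData_holds κ γ hγ
  haveI : Module.Finite (IwasawaAlgebra p) D.X :=
    (SelmerDualData.module_finite_of_isCyclotomic (W := VF) (κ := κ) hκ D) hγ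
  -- the divisibility over `F`
  obtain ⟨hX, g, hgmem, u, hιg⟩ := hDivF κ γ hκ hγ hγ' D
  haveI : (Module.charIdeal (IwasawaAlgebra p) D.X).IsPrincipal := charIdeal_isPrincipal_holds p D.X
  obtain ⟨fE, hchar⟩ := Submodule.IsPrincipal.principal (Module.charIdeal (IwasawaAlgebra p) D.X)
  have hchar' : D.charIdeal = Ideal.span {fE} := hchar
  have hgmem' : g ∈ Ideal.span {fE} := by rw [← hchar']; exact hgmem
  obtain ⟨h, hgh⟩ := Ideal.mem_span_singleton'.mp hgmem'
  -- the analytic side over `ℚ` for `V`: `t_V = ϖ [0]⁺_f = L(V,1)/Ω_V`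
  set sV : ℚ := ratPlusSymbol f 0 with hsV
  set tV : ℚ := ϖ * sV with htV
  have hΩV : (V.realPeriodRat : ℂ) ≠ 0 := by exact_mod_cast V.realPeriodRat_pos_holds.ne'
  have hLvalV : V.entireLFunction 1 = (((sV : ℝ) * plusPeriod f : ℝ) : ℂ) := hf.entireLFunction_one_eq
  have hqV' : V.entireLFunction 1 / (V.realPeriodRat : ℂ) = ((tV : ℚ) : ℂ) := by
    rw [hLvalV, ← hϖ, div_eq_iff hΩV, htV]
    push_cast
    ring
  have htV0 : tV ≠ 0 := by
    intro h0
    apply hLV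
    have := (div_eq_iff hΩV).mp hqV'
    rw [this, h0]
    simp
  have hϖ0 : ϖ ≠ 0 := fun h0 ↦ htV0 (by rw [htV, h0, zero_mul])
  have hsV0 : sV ≠ 0 := fun h0 ↦ htV0 (by rw [htV, h0, mul_zero])
  obtain ⟨-, -, -, hshaV⟩ := Wuthrich2014.shaAn_eq_of_L_one_div_eq hGZK V hLV hqV'
  -- the analytic side over `ℚ` for `W` and the middle branch (both parities)
  obtain ⟨ϖm, S, tW, hBmid, hqW', htW0, hS0, hvtW, hvϖm⟩ :=
    XMultCyclotomicPrime.exists_midBranch_datum p V W hmod hp2 C hC hmult hadd hf hpN hap hap1 ϖ ϖ'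
      hϖ hϖ' hϖ0 hLW
  have hBmid' : PowerSeries.constantCoeff (B (p / 2)) = a⁻¹ * ((S : ℚ) : ℚ_[p]) := hBmid
  obtain ⟨-, -, -, hshaW⟩ := Wuthrich2014.shaAn_eq_of_L_one_div_eq hGZK W hLW hqW'
  -- `ϖ' ≠ 0` (`Ω⁻_f > 0`)
  have hϖ'0 : ϖ' ≠ 0 := by
    intro h0
    have hpos : 0 < minusPeriod f := IsNewform0.minusPeriod_pos_holds hf.1 hf.coeffField_eq_bot
    rw [h0, Rat.cast_zero, zero_mul] at hϖ'
    exact hpos.ne' hϖ'.symm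
  -- the product over the branches `0 < i < p − 1`: `∏ B_i = B_mid · o`
  have hmidmem : p / 2 ∈ Finset.Ico 1 (p - 1) := by
    rw [Finset.mem_Ico]
    constructor <;> omega
  have hprod : ∏ i ∈ Finset.Ico 1 (p - 1), B i =
      B (p / 2) * ∏ i ∈ (Finset.Ico 1 (p - 1)).erase (p / 2), B i := by
    rw [Finset.mul_prod_erase _ _ hmidmem]
  have hιg' : iwasawaToPowerSeries p g =
      PowerSeries.C (((u : ℤ_[p]) : ℚ_[p]) * (ϖ : ℚ_[p]) ^ (p / 2) * (ϖ' : ℚ_[p]) ^ (p / 2)) *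
        (Ls * ∏ i ∈ Finset.Ico 1 (p - 1), B i) := hιg
  have hO' : o ≠ 0 := hO
  -- the constant term `g(0)`
  have hg0 : ((PowerSeries.constantCoeff g : ℤ_[p]) : ℚ_[p]) =
      ((u : ℤ_[p]) : ℚ_[p]) * (ϖ : ℚ_[p]) ^ (p / 2) * (ϖ' : ℚ_[p]) ^ (p / 2) *
        (PowerSeries.constantCoeff Ls * ((a⁻¹ * ((S : ℚ) : ℚ_[p])) * o)) := by
    rw [← constantCoeff_iwasawaToPowerSeries p g, hιg', hprod]
    simp only [map_mul, map_prod, PowerSeries.constantCoeff_C, hBmid']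
    rw [← ho]
  -- `g(0)·μ = (u ϖ^m ϖ'^m a⁻¹ e) · λ · s_V · S · o`
  have hsVQ' : ((ratPlusSymbol f 0 : ℚ) : ℚ_[p]) = ((sV : ℚ) : ℚ_[p]) := by rw [hsV]
  set U : ℚ_[p] := ((u : ℤ_[p]) : ℚ_[p]) * (ϖ : ℚ_[p]) ^ (p / 2) * (ϖ' : ℚ_[p]) ^ (p / 2) *
    a⁻¹ * e with hU
  have hg0μ : ((PowerSeries.constantCoeff g : ℤ_[p]) : ℚ_[p]) * μ =
      U * lam * ((sV : ℚ) : ℚ_[p]) * ((S : ℚ) : ℚ_[p]) * o := by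
    rw [hg0]
    have : ((u : ℤ_[p]) : ℚ_[p]) * (ϖ : ℚ_[p]) ^ (p / 2) * (ϖ' : ℚ_[p]) ^ (p / 2) *
        (PowerSeries.constantCoeff Ls * ((a⁻¹ * ((S : ℚ) : ℚ_[p])) * o)) * μ =
        ((u : ℤ_[p]) : ℚ_[p]) * (ϖ : ℚ_[p]) ^ (p / 2) * (ϖ' : ℚ_[p]) ^ (p / 2) *
        ((PowerSeries.constantCoeff Ls * μ) * ((a⁻¹ * ((S : ℚ) : ℚ_[p])) * o)) := by ring
    rw [this, hLs, hsVQ', hU]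
    ring
  -- `g(0) = h(0) · fE(0)`
  have hg0' : (PowerSeries.constantCoeff g : ℤ_[p]) =
      PowerSeries.constantCoeff h * PowerSeries.constantCoeff fE := by
    rw [← hgh, map_mul]
  -- non-vanishing of `g(0)`, `fE(0)`, `h(0)`
  have hsVQ : ((sV : ℚ) : ℚ_[p]) ≠ 0 := by exact_mod_cast hsV0
  have hSQ : ((S : ℚ) : ℚ_[p]) ≠ 0 := by exact_mod_cast hS0
  have hϖQ : ((ϖ : ℚ) : ℚ_[p]) ≠ 0 := by exact_mod_cast hϖ0
  have hϖ'Q : ((ϖ' : ℚ) : ℚ_[p]) ≠ 0 := by exact_mod_cast hϖ'0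
  have hU0 : U ≠ 0 := by
    rw [hU]
    exact mul_ne_zero (mul_ne_zero (mul_ne_zero (mul_ne_zero (coe_units_ne_zero p u)
      (pow_ne_zero _ hϖQ)) (pow_ne_zero _ hϖ'Q)) (inv_ne_zero ha0)) he0
  have hg0ne : PowerSeries.constantCoeff g ≠ 0 := by
    intro h0'
    have h' : U * lam * ((sV : ℚ) : ℚ_[p]) * ((S : ℚ) : ℚ_[p]) * o = 0 := by
      rw [← hg0μ, h0', PadicInt.coe_zero, zero_mul]
    exact mul_ne_zero (mul_ne_zero (mul_ne_zero (mul_ne_zero hU0 hlam) hsVQ) hSQ) hO' h'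
  have hfE0 : PowerSeries.constantCoeff fE ≠ 0 := by
    intro h0'
    apply hg0ne
    rw [hg0', h0', mul_zero]
  set h0 : ℚ_[p] := ((PowerSeries.constantCoeff h : ℤ_[p]) : ℚ_[p]) with hh0
  have hh0ne : h0 ≠ 0 := by
    rw [hh0]
    intro h0'
    apply hg0ne
    rw [hg0', (PadicInt.coe_eq_zero.mp h0'), zero_mul]
  have hh0val : 0 ≤ h0.valuation := by
    rw [hh0]
    exact PadicInt.valuation_coe_nonneg
  -- CONTROL: `fE(0) ≠ 0 ⇒ Sel_{p^∞}(V_F/F)` finite, hence `V(F)` finite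
  have hSelfin : Finite (VF.selmerGroupPInfty p) :=
    SelmerControl.finite_selmerGroupPInfty_of_constantCoeff_ne_zero VF hγ D hX hchar' hfE0
  haveI hEF : Finite VF.toAffine.Point := ((VF.finite_selmerGroupPInfty_iff p).mp hSelfin).1
  haveI : Finite (VF.selmerGroupPInfty p) := hSelfin
  -- GREENBERG over `F`
  obtain ⟨u₁, hu₁⟩ := hGrF κ γ hκ hγ D hX fE hchar' hSelfin
  -- RESTRICTION `ℚ → F`: `ord_p #Ш(V) + ord_p #Ш(W) ≤ ord_p #Sel(V_F)`
  have hR := padicValNat_shaOrder_add_le_selmer_cyclotomicPrime p F V W hp2 C hC hfinV hfinW hSelfin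
  -- names
  set TF : ℚ_[p] := (Nat.card (AddCommGroup.primaryComponent VF.toAffine.Point p) : ℚ_[p]) with hTF
  set SelF : ℚ_[p] := (Nat.card (VF.selmerGroupPInfty p) : ℚ_[p]) with hSelF
  set vF : ℕ := padicValNat p VF.tamagawaProduct with hvF
  have hTF0 : TF ≠ 0 := by rw [hTF]; exact_mod_cast Nat.card_pos.ne'
  have hSelF0 : SelF ≠ 0 := by rw [hSelF]; exact_mod_cast Nat.card_pos.ne'
  have hp0 : (p : ℚ_[p]) ≠ 0 := by exact_mod_cast hp.out.ne_zero
  -- KEY identity in `ℚ_p` (`λ` cancelled): `(s_V · S · o · T_F²) · U = h(0) · μ · (u₁ · (p^{v_F} · #Sel_F))`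
  have key : (((sV : ℚ) : ℚ_[p]) * ((S : ℚ) : ℚ_[p]) * o * TF ^ 2) * U =
      h0 * μ * (((u₁ : ℤ_[p]) : ℚ_[p]) * ((p : ℚ_[p]) ^ vF * SelF)) := by
    apply mul_right_cancel₀ hlam
    have hg0Q : ((PowerSeries.constantCoeff g : ℤ_[p]) : ℚ_[p]) =
        h0 * ((PowerSeries.constantCoeff fE : ℤ_[p]) : ℚ_[p]) := by
      rw [hg0', hh0]; push_cast; ring
    calc (((sV : ℚ) : ℚ_[p]) * ((S : ℚ) : ℚ_[p]) * o * TF ^ 2) * U * lam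
        = (U * lam * ((sV : ℚ) : ℚ_[p]) * ((S : ℚ) : ℚ_[p]) * o) * TF ^ 2 := by ring
      _ = (h0 * ((PowerSeries.constantCoeff fE : ℤ_[p]) : ℚ_[p])) * μ * TF ^ 2 := by rw [← hg0μ, hg0Q]
      _ = h0 * μ * (((PowerSeries.constantCoeff fE : ℤ_[p]) : ℚ_[p]) * TF ^ 2) := by ring
      _ = h0 * μ * (((u₁ : ℤ_[p]) : ℚ_[p]) * lam * (p : ℚ_[p]) ^ vF * SelF) := by rw [hu₁]
      _ = h0 * μ * (((u₁ : ℤ_[p]) : ℚ_[p]) * ((p : ℚ_[p]) ^ vF * SelF)) * lam := by ring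
  -- valuations of `key`
  have hvU : U.valuation = ((p / 2 : ℕ) : ℤ) * (padicValRat p ϖ + padicValRat p ϖ') + e.valuation := by
    rw [hU, Padic.valuation_mul (mul_ne_zero (mul_ne_zero (mul_ne_zero (coe_units_ne_zero p u)
        (pow_ne_zero _ hϖQ)) (pow_ne_zero _ hϖ'Q)) (inv_ne_zero ha0)) he0,
      Padic.valuation_mul (mul_ne_zero (mul_ne_zero (coe_units_ne_zero p u)
        (pow_ne_zero _ hϖQ)) (pow_ne_zero _ hϖ'Q)) (inv_ne_zero ha0),
      Padic.valuation_mul (mul_ne_zero (coe_units_ne_zero p u) (pow_ne_zero _ hϖQ)) (pow_ne_zero _ hϖ'Q),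
      Padic.valuation_mul (coe_units_ne_zero p u) (pow_ne_zero _ hϖQ),
      Padic.valuation_pow, Padic.valuation_pow,
      Padic.valuation_inv, hva, valuation_coe_units_eq_zero,
      Padic.valuation_ratCast, Padic.valuation_ratCast]
    ring
  have hu1S : ((u₁ : ℤ_[p]) : ℚ_[p]) * ((p : ℚ_[p]) ^ vF * SelF) ≠ 0 :=
    mul_ne_zero (coe_units_ne_zero p u₁) (mul_ne_zero (pow_ne_zero _ hp0) hSelF0)
  have hval := congrArg Padic.valuation key
  rw [Padic.valuation_mul (mul_ne_zero (mul_ne_zero (mul_ne_zero hsVQ hSQ) hO') (pow_ne_zero 2 hTF0)) hU0,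
    Padic.valuation_mul (mul_ne_zero (mul_ne_zero hsVQ hSQ) hO') (pow_ne_zero 2 hTF0),
    Padic.valuation_mul (mul_ne_zero hsVQ hSQ) hO', Padic.valuation_mul hsVQ hSQ,
    Padic.valuation_pow, Padic.valuation_ratCast, Padic.valuation_ratCast, hvU,
    Padic.valuation_mul (mul_ne_zero hh0ne hμ0) hu1S, Padic.valuation_mul hh0ne hμ0, hμe,
    Padic.valuation_mul (coe_units_ne_zero p u₁) (mul_ne_zero (pow_ne_zero _ hp0) hSelF0),
    valuation_coe_units_eq_zero, Padic.valuation_mul (pow_ne_zero _ hp0) hSelF0, Padic.valuation_pow,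
    Padic.valuation_p] at hval
  -- `v(T_F) = ord_p #V(F)`, `v(#Sel_F) = ord_p #Sel_{p^∞}(V_F)`
  have hvTF : TF.valuation = (padicValNat p (Nat.card VF.toAffine.Point) : ℤ) := by
    rw [hTF, Padic.valuation_natCast, padicValNat_card_addPrimaryComponent p]
  have hvSelF : SelF.valuation = (padicValNat p (Nat.card (VF.selmerGroupPInfty p)) : ℤ) := by
    rw [hSelF, Padic.valuation_natCast]
  rw [hvTF, hvSelF] at hval
  -- `v(s_V) = v(t_V) − v(ϖ)`, `v(S) = v(t_W) − v(ϖ_mid)`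
  have hvsV : padicValRat p sV = padicValRat p tV - padicValRat p ϖ := by
    rw [htV, padicValRat.mul hϖ0 hsV0]; ring
  have hvS : padicValRat p S = padicValRat p tW - padicValRat p ϖm := by rw [hvtW]; ring
  -- the restriction inequality, cast to `ℤ`
  have hR' : (padicValNat p V.shaOrder : ℤ) + padicValNat p W.shaOrder ≤
      (padicValNat p (Nat.card (VF.selmerGroupPInfty p)) : ℤ) := by exact_mod_cast hR
  -- conclusion
  have hSV0 : (V.shaOrder : ℚ) ≠ 0 := by exact_mod_cast (V.shaOrder_pos hfinV).ne'
  have hSW0 : (W.shaOrder : ℚ) ≠ 0 := by exact_mod_cast (W.shaOrder_pos hfinW).ne'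
  have hcV0 : (V.tamagawaProduct : ℚ) ≠ 0 := by exact_mod_cast V.tamagawaProduct_pos_holds.ne'
  have hcW0 : (W.tamagawaProduct : ℚ) ≠ 0 := by exact_mod_cast W.tamagawaProduct_pos_holds.ne'
  have hNV0 : ((Nat.card V.toAffine.Point : ℕ) : ℚ) ≠ 0 := by exact_mod_cast Nat.card_pos.ne'
  have hNW0 : ((Nat.card W.toAffine.Point : ℕ) : ℚ) ≠ 0 := by exact_mod_cast Nat.card_pos.ne'
  refine ⟨tV * (Nat.card V.toAffine.Point : ℚ) ^ 2 / (V.tamagawaProduct : ℚ),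
    tW * (Nat.card W.toAffine.Point : ℚ) ^ 2 / (W.tamagawaProduct : ℚ), hshaV, hshaW, ?_⟩
  rw [padicValRat.div (mul_ne_zero htV0 (pow_ne_zero 2 hNV0)) hcV0,
    padicValRat.mul htV0 (pow_ne_zero 2 hNV0), padicValRat.pow, padicValRat.of_nat, padicValRat.of_nat,
    padicValRat.div (mul_ne_zero htW0 (pow_ne_zero 2 hNW0)) hcW0,
    padicValRat.mul htW0 (pow_ne_zero 2 hNW0), padicValRat.pow, padicValRat.of_nat, padicValRat.of_nat,
    ← hvϖm]
  push_cast at hval hR' ⊢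
  linarith

end Core

end Summit.BirchSwinnertonDyer.Rank1Residual.Additive

end
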